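import Literature.NumberTheory.DiophantineApproximation.RidoutRationalsClass
import Literature.NumberTheory.DiophantineApproximation.RidoutRationals

/-!
# The `p`-adic Roth theorem over `ℚ` (Ridout) — rationals `|β| ≤ 1`, archimedean target `0`

Bombieri–Gubler [BombieriGubler2006] Thm. 6.2.3 for `K = ℚ`, `S ∋ ∞` with `α_∞ = 0`, targets
`θ_p ∈ \overline{ℚ_p}` roots of monic integer polynomials at the finite places, restricted to
rationals of absolute value `≤ 1` — PROVED, unconditionally: the class contradiction with a
partial archimedean share (`Ridout.false_of_class_abs`, `RidoutRationalsClass.lean`) fed into the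
Mahler-class reduction (`Ridout.finite_of_abs_le_one_of_class`, `RidoutRationals.lean`).

* `Ridout.finite_of_abs_le_one` — for `κ > 2` only finitely many `ρ ∈ ℚ` with `|ρ| ≤ 1` satisfy
  `|ρ| · ∏_{p ∈ S} min(1, ‖ρ − θ_p‖_p) ≤ den(ρ)^{−κ}`.

This extends the tree's `Ridout.finite_of_num_le` (bounded numerators = archimedean share
exactly `1`) to an arbitrary archimedean share, which is what the abc application
(`β = min(a,b)/c`) needs. Deliberately NOT here: `|β| > 1`, an algebraic archimedean target
`α_∞ ≠ 0`, number fields `K ≠ ℚ` (B–G Thm. 6.2.3 / 6.4.1 in full).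

## References

* [BombieriGubler2006] E. Bombieri, W. Gubler, *Heights in Diophantine Geometry*, CUP 2006,
  Thm. 6.2.3, 6.2.5–6.2.6, §6.4.
* [Ridout1958] D. Ridout, *The `p`-adic generalization of the Thue–Siegel–Roth theorem*,
  Mathematika 5 (1958) 40–48.
-/

noncomputable section

open Finset Real
open scoped Polynomial

namespace Literature.NumberTheory.DiophantineApproximation

namespace Ridout

/-- **Ridout's theorem over `ℚ`, archimedean target `0`, `|β| ≤ 1`** (Bombieri–Gubler Thm. 6.2.3
for `K = ℚ`, `α_∞ = 0`): for a finite set `S` of primes, roots `θ_p ∈ \overline{ℚ_p}` of monic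
`Q_p ∈ ℤ[X]` of degree `≥ 1`, and `κ > 2`, only finitely many rationals `ρ` with `|ρ| ≤ 1` satisfy
`|ρ| · ∏_{p∈S} min(1, ‖ρ − θ_p‖_p) ≤ den(ρ)^{−κ}` (for `|ρ| ≤ 1`, `den ρ = H(ρ)` and
`|ρ| = min(1, |ρ − 0|)`). Proof: `finite_of_abs_le_one_of_class` with the class contradiction
`false_of_class_abs`. [cite: BombieriGubler2006, Thm. 6.2.3 with 6.2.5–6.2.6 and §6.4 (K = ℚ, α_∞ = 0)] -/
theorem finite_of_abs_le_one (S : Finset Nat.Primes) (Q : Nat.Primes → ℤ[X])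
    (hQm : ∀ p ∈ S, (Q p).Monic) (hQd : ∀ p ∈ S, 1 ≤ (Q p).natDegree)
    (θ : ∀ p : Nat.Primes, @PadicAlgCl (p : ℕ) ⟨p.2⟩)
    (hθ : ∀ p ∈ S, Polynomial.aeval (θ p) (Q p) = 0) {κ : ℝ} (hκ : 2 < κ) :
    {ρ : ℚ | |(ρ : ℝ)| ≤ 1 ∧
      |(ρ : ℝ)| * (∏ p ∈ S, min (1 : ℝ) ‖(ρ : @PadicAlgCl (p : ℕ) ⟨p.2⟩) - θ p‖) ≤
        (ρ.den : ℝ) ^ (-κ)}.Finite :=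
  finite_of_abs_le_one_of_class S Q hQm hQd θ hθ hκ
    (fun c₀ hc₀ _ε hε μ hμ ν hν hsum hsupply =>
      false_of_class_abs S Q hQm hQd θ hθ c₀ hc₀ hε μ hμ ν hν hsum hsupply)

end Ridout

end Literature.NumberTheory.DiophantineApproximation

end
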